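import Summits.KontsevichZagierPeriods.KontsevichZagierPeriods.Theses.LinkTwistWrithe
import Summits.KontsevichZagierPeriods.KontsevichZagierPeriods.Theses.AyoubSpecialisation
import Summits.KontsevichZagierPeriods.KontsevichZagierPeriods.Theorems.HurwitzMicroSectorsNormalFormPrincipleSplitGlue

/-!
# Route LinkTwistWrithe — `DegreeKernel` (stmt-KontsevichZagierPeriods-4303) decomposed along `[π]`:
# `AyoubPiLocalKernel → AyoubPiCancellation → DegreeKernel`

Pure proof file (crux-strategist decomposition, rides with the crux item `--supports
stmt-KontsevichZagierPeriods-4303`). The crux `DegreeKernel` is Conjecture 1 of Kontsevich–Zagier in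
KERNEL FORM for the calculus ENLARGED by the signed-degree relators of the route ("degree is a
move"): `∀ c, KZ.eval c = 0 → c ∈ R'`, `R' = closure ((1a) ∪ (1b) ∪ (3) ∪ degreeRel)`. Its honest
status (route header, refuter / grounder notes) is GPC-strength: RESTATED — implied by the summit
through one-sheet absorption, and giving the summit back through the engine `DegreeTransfer`
(`closes`). This file proves the typed split of the crux onto the two SHARED items of route
AyoubSpecialisation's `[π]`-localisation cut (Kontsevich–Zagier 2001 §4.1 `P̂ = P[(2πi)⁻¹]`;
Ayoub 2014 Def. 6 / Conj. 7):

* `Sub₁ = AyoubPiLocalKernel` (stmt-KontsevichZagierPeriods-0541): for every pinned product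
  `P n r = [closed unit disc] ⋆ r`, every value-zero formal combination becomes a KZ relation after
  finitely many `P`-multiplications — Conjecture 1 for the effective period ring LOCALISED at `[π]`
  (all the transcendence content);
* `Sub₂ = AyoubPiCancellation` (stmt-KontsevichZagierPeriods-0540): `P`-multiplication reflects
  relations — the effective-versus-localised seam, transcendence-free, printed open
  (Huber–Wüstholz 2022 App. A.4).

Contents (self-contained against the Literature API and ONE landed lemma, `exists_pinnedProduct`):
1. `degreeRel`, `enlargedRelations` — the fourth generator set and `R'`, copied VERBATIM from the body
   of `DegreeKernel` (so the crux is `∀ c, eval c = 0 → c ∈ enlargedRelations` by `rfl`).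
2. `changeOfVariablesRel_subset_degreeRel` — RULE (2) IS THE ONE-SHEET SIGNED-DEGREE RELATOR: the
   rule-(2) datum `(r, r', Φ, Φ')` is the degree datum `N = 1, σ 0 = r.domain, ε 0 = 1, d = 1` (count
   `1` everywhere on `r'.domain = Φ '' r.domain`, a fortiori a.e.; `[r] − (1 : ℤ) • [r'] = [r] − [r']`).
   This is, by name and signature, the registered stub `stub_oneSheet` of line `Lines/birth.lean`
   of this crux, now PROVED.
3. `relations_le_enlargedRelations` — hence `KZ.relations ≤ R'`.
4. `DegreeKernel_of_subs : AyoubPiLocalKernel → AyoubPiCancellation → DegreeKernel` — a pinned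
   product exists (`HurwitzMicroSectors.NormalFormPrincipleSplitGlue.exists_pinnedProduct`, landed,
   so neither `∀ P`-hypothesis is consumed vacuously); for `c ∈ ker eval`, `Sub₁` gives
   `(lift (of ∘ P))^[N] c ∈ KZ.relations`, `Sub₂` peels the `N` factors (induction on `N`), and step 3
   moves `c ∈ KZ.relations` into `R'`. (The antecedents are the decls of route AyoubSpecialisation,
   i.e. items 0541 / 0540 BY NAME; any other route's copies of the two statements are definitionally
   equal to them, so the implication serves a glue typed either way.)

Deliberately NOT here: any claim about items 0541 / 0540 themselves (open), about `DegreeTransfer`,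
or about the birth line's open stub `stub_foldedVolumeKernel`. Exactness of the cut modulo the
engine (`DegreeTransfer → (DegreeKernel ↔ Sub₁ ∧ Sub₂)`, through `closes` and the landed
`summit_iff_ayoubPiLocalKernel_and_ayoubPiCancellation`) is recorded in the strategist's census, not
restated. Sources: M. Kontsevich, D. Zagier, *Periods* (2001), §1.2 rule (2) / Conjecture 1, §4.1;
J. Ayoub, *Periods and the conjectures of Grothendieck and Kontsevich–Zagier*, EMS Newsl. 91 (2014),
Def. 6 / Conj. 7; A. Huber, G. Wüstholz, *Transcendence and linear relations of 1-periods* (2022),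
App. A.4.
-/

noncomputable section

namespace Summit.KontsevichZagierPeriods.LinkTwistWrithe.DegreeKernelSplit

open Set MeasureTheory
open Literature.NumberTheory.Transcendental
open Summit.KontsevichZagierPeriods.KontsevichZagierPeriods.Theses.LinkTwistWrithe (DegreeKernel)
open Summit.KontsevichZagierPeriods.KontsevichZagierPeriods.Theses.AyoubSpecialisation
  (AyoubPiLocalKernel AyoubPiCancellation)

/-! ## The enlarged calculus `R'` (verbatim from the crux) -/

/-- The SIGNED-DEGREE RELATORS (fourth generator set of the route's enlarged calculus), copied
verbatim from the body of `DegreeKernel`: finite families of `ℚ`-semialgebraic sheets `σ k ⊆ r.domain`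
(co-null union), injective differentiable `ℚ`-semialgebraic maps `Φ k` into `r'.domain` with integer
weights `ε k` and a.e.-constant signed sheet count `d`, the integrand identity
`r.integrand = Σ_k 1_{σ k} · ε k · (r'.integrand ∘ Φ k) · |det Φ' k|`, and the relator `[r] − d • [r']`.
[cite: KontsevichZagier2001, §1.2 rule (2)] -/
def degreeRel : Set KZ.FormalRep :=
  {c | ∃ (n N : ℕ) (d : ℤ) (ε : Fin N → ℤ) (r r' : Literature.NumberTheory.Transcendental.KZ.IntegralRep n) (σ : Fin N → Set (Fin n → ℝ)) (Φ : Fin N → (Fin n → ℝ) → (Fin n → ℝ)) (Φ' : Fin N → (Fin n → ℝ) → ((Fin n → ℝ) →L[ℝ] (Fin n → ℝ))), (∀ k, Literature.ModelTheory.ExponentialFields.IsSemialgebraic ℚ (σ k)) ∧ (∀ k, σ k ⊆ r.domain) ∧ MeasureTheory.volume (r.domain \ ⋃ k, σ k) = 0 ∧ (∀ k, Literature.NumberTheory.Transcendental.IsSemialgebraicMapOn ℚ (σ k) (Φ k)) ∧ (∀ k, ∀ x ∈ σ k, HasFDerivWithinAt (Φ k) (Φ' k x) (σ k) x) ∧ (∀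 k, Set.InjOn (Φ k) (σ k)) ∧ (∀ k, Φ k '' σ k ⊆ r'.domain) ∧ (∀ᵐ y ∂(MeasureTheory.volume.restrict r'.domain), (∑ k : Fin N, (Φ k '' σ k).indicator (fun _ => ε k) y) = d) ∧ (∀ x ∈ ⋃ k, σ k, r.integrand x = ∑ k : Fin N, (σ k).indicator (fun y => (ε k : ℝ) * (r'.integrand (Φ k y) * |(Φ' k y).det|)) x) ∧ c = Literature.NumberTheory.Transcendental.KZ.of r - d • Literature.NumberTheory.Transcendental.KZ.of r'}

/-- The relation subgroup `R'` of the enlarged calculus: generated by (1a), (1b), (3) and the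
signed-degree relators. [cite: KontsevichZagier2001, §1.2] -/
def enlargedRelations : AddSubgroup KZ.FormalRep :=
  AddSubgroup.closure (KZ.domainAddRel ∪ KZ.integrandAddRel ∪ KZ.newtonLeibnizRel ∪ degreeRel)

/-! ## Rule (2) is the one-sheet signed-degree relator -/

/-- **Rule (2) is the one-sheet signed-degree relator** (the registered stub `stub_oneSheet` of line
`Lines/birth.lean` of this crux, same statement): a `changeOfVariablesRel` instance `(r, r', Φ, Φ')`
is the degree datum with `N = 1`, the single sheet `σ 0 = r.domain` (semialgebraic, exhausting the
domain), the map `Φ` (semialgebraic, differentiable within the sheet, injective), image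
`Φ '' r.domain = r'.domain`, weight `ε 0 = 1`, signed count `d = 1` on all of `r'.domain` (hence a.e.
for `volume.restrict r'.domain`, the domain being measurable), integrand identity
`f = 1 · (f' ∘ Φ) · |det Φ'|` on the sheet, and `[r] − (1 : ℤ) • [r'] = [r] − [r']`.
[cite: KontsevichZagier2001, §1.2 rule (2)] -/
theorem changeOfVariablesRel_subset_degreeRel : KZ.changeOfVariablesRel ⊆ degreeRel := by
  rintro c ⟨n, r, r', Φ, Φ', hsa, hder, hinj, hdom, hf, rfl⟩
  refine ⟨n, 1, 1, fun _ => 1, r, r', fun _ => r.domain, fun _ => Φ, fun _ => Φ',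
    ?_, ?_, ?_, ?_, ?_, ?_, ?_, ?_, ?_, ?_⟩
  · intro _; exact r.isSemialgebraic_domain
  · intro _; exact Subset.rfl
  · simp [Set.iUnion_const]
  · intro _; exact hsa
  · intro _ x hx; exact hder x hx
  · intro _; exact hinj
  · intro _; rw [hdom]
  · refine ae_restrict_of_forall_mem (KZ.IntegralRep.measurableSet_domain_holds r') fun y hy => ?_
    have hy' : y ∈ Φ '' r.domain := hdom ▸ hy
    simp [Set.indicator_of_mem hy']
  · intro x hx
    have hx' : x ∈ r.domain := by simpa [Set.iUnion_const] using hx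
    simp [Set.indicator_of_mem hx', hf x hx']
  · simp

/-- **Every KZ relation is an `R'` relation**: (1a), (1b), (3) are generators of both, and rule (2)
is the one-sheet signed-degree relator (`changeOfVariablesRel_subset_degreeRel`).
[cite: KontsevichZagier2001, §1.2] -/
theorem relations_le_enlargedRelations : KZ.relations ≤ enlargedRelations := by
  refine (AddSubgroup.closure_le _).mpr ?_
  rintro c (((hc | hc) | hc) | hc)
  · exact AddSubgroup.subset_closure (Or.inl (Or.inl (Or.inl hc)))
  · exact AddSubgroup.subset_closure (Or.inl (Or.inl (Or.inr hc)))
  · exact AddSubgroup.subset_closure (Or.inr (changeOfVariablesRel_subset_degreeRel hc))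
  · exact AddSubgroup.subset_closure (Or.inl (Or.inr hc))

/-- The kernel conjecture for KZ's own calculus gives the crux (one-sheet absorption): if
`ker eval ≤ KZ.relations` then `ker eval ≤ R'`. [cite: KontsevichZagier2001, §1.2 Conjecture 1] -/
theorem degreeKernel_of_kzKernelConjecture (h : KZKernelConjecture) : DegreeKernel :=
  fun c hc => relations_le_enlargedRelations (h c hc)

/-! ## The decomposition: `Sub₁ → Sub₂ → DegreeKernel` -/

/-- **The `[π]`-split of `DegreeKernel` glues** (crux-strategist decomposition of
stmt-KontsevichZagierPeriods-4303 onto the shared items stmt-0541 / stmt-0540, by the names of route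
AyoubSpecialisation): `AyoubPiLocalKernel → AyoubPiCancellation → DegreeKernel`. Pinned product
(`exists_pinnedProduct`) → `π`-local kernel gives `(lift (of ∘ P))^[N] c ∈ KZ.relations` for
`c ∈ ker eval` → `π`-cancellation peels the `N` factors (induction on `N`) →
`relations_le_enlargedRelations`. [cite: Ayoub2014, Def. 6 and Conj. 7] -/
theorem DegreeKernel_of_subs : AyoubPiLocalKernel → AyoubPiCancellation → DegreeKernel := by
  intro h₁ h₂
  -- a pinned product `[π] ⋆ ·` exists
  obtain ⟨P, hP⟩ :=
    Summit.KontsevichZagierPeriods.HurwitzMicroSectors.NormalFormPrincipleSplitGlue.exists_pinnedProduct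
  intro c hc
  -- 0541: some `[π]^N ⋆ c` is a KZ relation
  obtain ⟨N, hN⟩ := h₁ P hP c hc
  -- 0540 peels the `N` factors `[π]`
  have hrel : c ∈ KZ.relations := by
    clear hc
    induction N with
    | zero => simpa using hN
    | succ N ih =>
      exact ih (h₂ P hP _ (by simpa only [Function.iterate_succ_apply'] using hN))
  -- KZ relations are `R'` relations
  exact relations_le_enlargedRelations hrel

end Summit.KontsevichZagierPeriods.LinkTwistWrithe.DegreeKernelSplit

end
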